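import Summits.BirchSwinnertonDyer.Rank1Residual.AdditivePotMult.Descent
import Summits.BirchSwinnertonDyer.Rank1Residual.AdditivePotMult.QuadraticBaseChangeMilneQuotientOddPartDischarge
import Literature.NumberTheory.EllipticCurves.HeegnerPointsKolyvaginExceptionalTwistProofs
import Literature.NumberTheory.EllipticCurves.BSDInvariantsProofs
import Literature.NumberTheory.EllipticCurves.MordellWeilRankZeroProofs
import HarnessLib

/-!
# The base-change-and-descend theorem with the `ord_p`-shaped Milne binder and NO `Ш(E_K)`
# hypothesis; the first A65-FREE descent ENDs (row T-MIL-SHA, FILE D-2; seat n1011-p01 GEN 7)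

HONEST FRAMING (cell `b2b-bsdres`, run/shared/lean/b2b/bsd-rank1-residual/, verbatim in every
file): the goal of the cell is to DELETE the COMBINATION-SHAPED residual classes of the
Birch–Swinnerton-Dyer formula for ALL analytic-rank `≤ 1` elliptic curves over `ℚ` — "full BSD
formula for every rank `≤ 1` curve in class `C`" assembled STRICTLY from published theorems — so
that the rank-`≤ 1` remainder becomes exactly the CONSTRUCTION-SHAPED classes, which are TYPED
(missing-input `Prop`s), NOT attempted. This is not "finishing BSD". Sub-classes X3♯(M) / X4(M)
(additive, potentially multiplicative prime; base-change-and-descend): a RESEARCH ROUTE; they stay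
CONSTRUCTION-SHAPED; nothing is booked by this file; no mark / label moved. THEOREMS ONLY: no
definition, no named fact, no `sorry`.

## What (row T-MIL-SHA, `cells/n1011/skel/T-MIL-SHA.md` §2, FILE D-2)

The cell's descent theorem `Descent.bsdp_of_pPartOver_of_bsdp_twist` (seat additive-p1) proves
`BSD(E,p) ⇐ MissingPPartOverAt(E_K, p) ∧ BSD(E^{(d_K)}, p)` from two binders supplied by the named
fact A65 `Milne1972.bsdQuotient_baseChange_quadratic`: `hshaK : Ш(E_K/K) finite` and Milne's real
identity `hWR : #Ш(W')Reg(W')Ω(W')∏c_w/#W'(K)_tors² = RHS(W)·RHS(Wd)`. Conjunct (1) `hshaK` is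
ALREADY A TREE THEOREM (`Literature.NumberTheory.EllipticCurves.shaFinite_baseChange_of_shaFinite`,
file `HeegnerPointsKolyvaginExceptionalTwistProofs`, Dokchitser–Dokchitser 2010 Lemma 4.14 — all
ranks, either signature; referee 1 RETURN-1 / p16 first say 2026-08-21: consume by name, here
wrapped in the model currency as `shaFinite_baseChange_quadratic`); row T-MIL-ODD FILES C-4a/C-4b made the
`ord_p`-shape `hWR_p : ∃ q ∈ ℚ_{>0}, v_p(q) = 0 ∧ (Milne's quotient) = q·RHS(W)·RHS(Wd)` a THEOREM
in rank `0` over an imaginary quadratic `K` with `d_K` odd squarefree at odd `p` on the populations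
S₁ (every odd `p`) / S₂ (`p ≥ 5`). This file composes them WITHOUT editing anybody's file:

* `shaFinite_baseChange_quadratic` — `W'.ShaFinite ⟸ W.ShaFinite ∧ Wd.ShaFinite` in the model
  currency (`Wd = C_d • W^{(d_K)}`, `W' = C' • W_K`): the tree theorem + `shaFinite_variableChange_iff_holds`;
* `shaAnOver_mul_eq_ordp` — the identity (★) with the factor:
  `#Ш_an(W')·#Ш(W)·#Ш(Wd)·q = #Ш_an(W)·#Ш_an(Wd)·#Ш(W')` from `hWR_q` (`q > 0`);
* `bsdp_of_pPartOver_of_bsdp_twist_ordp` — **the descent theorem with `hWR ↦ hWR_p` (at THIS `p`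
  only) and `hshaK` DISCHARGED** (`shaFinite_baseChange_quadratic` fed by `hGZK`): same
  conclusion `BSDp W p`, same other binders as `Descent.bsdp_of_pPartOver_of_bsdp_twist`;
* `bsdp_of_pPartOver_of_bsdp_twist_rankZero_semistable` /
  `bsdp_of_pPartOver_of_bsdp_twist_rankZero_semistable_or_addv` — **the first base-change-and-descend
  ENDs with NO Milne hypothesis at all**: for `W/ℚ`, `Wd = C_d • W^{(d_K)}`, `W' = C' • W_K` globally
  minimal, `K` IMAGINARY quadratic with `d_K` odd squarefree (e.g. `K = ℚ(√−p)`, `p ≡ 3 mod 4`),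
  `W` and `Wd` of ANALYTIC RANK `0`, `W` on S₁ (good, multiplicative, or `ℓ ∣ d_K` with `Wd`
  multiplicative, at every place) resp. S₂ (additionally additive places of residue characteristic
  `≥ 5` prime to `d_K`), and `p` odd resp. `p ≥ 5`:
  **`BSDp W p ⟸ MissingPPartOverAt W' p ∧ BSDp Wd p`**, the ONLY other hypotheses being the cell's
  two standing named facts `hGZK` (Gross–Zagier–Kolyvagin) and `hmod` (modularity / entire `L`).

HONEST LIMITS: rank `0` for BOTH `W` and `Wd` (positive rank needs the regulator comparison, not in
the tree), `K` imaginary (real `K` needs the archimedean comparison at two real places), `d_K` odd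
squarefree, `p` odd; X3♯(M)/X4(M) stay CONSTRUCTION-SHAPED — the over-`K` input `MissingPPartOverAt`
is untouched (the located gap of `ClassTheorems.lean`); `ClassTheorems.lean` / `Descent.lean` are
NOT edited (their A65-shaped theorems stand; these are twins); TOOL theorems; closes no class; moves
no mark; A65 is simply not consumed on the stated populations.

References: J. S. Milne, Invent. Math. 17 (1972) §1 Thm. 1, §2 [Milne1972ArithmeticAV];
T. Dokchitser, V. Dokchitser, Ann. of Math. 172 (2010) §2.1, Lemma 4.14
[DokchitserDokchitserAnnals2010]; R. L. Miller, LMS J. Comput. Math. 14 (2011) Def. 1.1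
[Miller2011LMS]; B. Gross, D. Zagier, Invent. Math. 84 (1986); V. Kolyvagin (1990) [the cell's
`hGZK`].
-/

noncomputable section

open scoped Classical

open WeierstrassCurve NumberField IsDedekindDomain Rat.HeightOneSpectrum
  Literature.NumberTheory.EllipticCurves Literature.NumberTheory.EllipticCurves.Rank1Residual
  Literature.NumberTheory.EllipticCurves.Rank1Residual.Typed

namespace Summit.BirchSwinnertonDyer.Rank1Residual.AdditivePotMult

/-! ## §1 `Ш(W'/K)` finite in the model currency, (★) with a factor, the `ord_p` descent theorem -/

section Descent

variable (W : WeierstrassCurve ℚ) [W.IsElliptic] (p : ℕ) [Fact p.Prime]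
  (K : Type) [Field K] [NumberField K]
  (Wd : WeierstrassCurve ℚ) [Wd.IsElliptic] (W' : WeierstrassCurve K) [W'.IsElliptic]

omit [Fact p.Prime] [Wd.IsElliptic] [W'.IsElliptic] in
/-- **A65 conjunct (1) in the model currency: `Ш(W'/K)` is finite when `Ш(W/ℚ)`, `Ш(Wd/ℚ)` are**
(`[K:ℚ] = 2`, either signature, any rank, `Wd` any `ℚ`-model of `W^{(d_K)}`, `W'` any `K`-model of
`W_K`) — the TREE theorem `Literature.NumberTheory.EllipticCurves.shaFinite_baseChange_of_shaFinite`
(Dokchitser–Dokchitser 2010 Lemma 4.14: `Sel_{p^∞}` comparison with cokernel killed by `8` at every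
prime, `Ш` torsion) transported along `Ш(C • X) ≃ Ш(X)` (`shaFinite_variableChange_iff_holds`). This
is the `hshaK` binder of `Descent.bsdp_of_pPartOver_of_bsdp_twist`, WITHOUT A65.
[cite: DokchitserDokchitserAnnals2010, Lemma 4.14 (proof)] [cite: Milne1972ArithmeticAV, §1 Thm. 1] -/
theorem shaFinite_baseChange_quadratic (h2 : Module.finrank ℚ K = 2)
    (hWd : ∃ C : VariableChange ℚ, C • W.quadraticTwist (NumberField.discr K : ℚ) = Wd)
    (hW' : ∃ C : VariableChange K, C • W.baseChange K = W')
    (hW : W.ShaFinite) (hd : Wd.ShaFinite) : W'.ShaFinite := by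
  obtain ⟨Cd, hCd⟩ := hWd
  obtain ⟨C', hC'⟩ := hW'
  subst hCd hC'
  exact (shaFinite_variableChange_iff_holds (W.baseChange K) C').mpr
    (shaFinite_baseChange_of_shaFinite W K h2 hW ((shaFinite_variableChange_iff_holds _ Cd).mp hd))

omit [Fact p.Prime] in
/-- **(★) with a factor.** From `hWR_q : #Ш(W')Reg(W')Ω(W')∏c_w(W')/#W'(K)_tors² = q·RHS(W)·RHS(Wd)`
with `q > 0` (all three `Ш` finite): `#Ш_an(W')·#Ш(W)·#Ш(Wd)·q = #Ш_an(W)·#Ш_an(Wd)·#Ш(W')` as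
complex numbers — the proof of `Descent.shaAnOver_mul_eq` run with the factor (Artin formalism
`leadingLCoeff_models_eq`, positivity of the `ℚ`-side invariants). [cite: Milne1972ArithmeticAV, §1 Thm. 1 and §2]
[cite: DokchitserDokchitserAnnals2010, §2.1] -/
theorem shaAnOver_mul_eq_ordp (hmod : hasEntireLFunction_rat) (h2 : Module.finrank ℚ K = 2)
    (hWd : ∃ C : VariableChange ℚ, C • W.quadraticTwist (NumberField.discr K : ℚ) = Wd)
    (hW' : ∃ C : VariableChange K, C • W.baseChange K = W')
    (hshaW : W.ShaFinite) (hshaD : Wd.ShaFinite) (hshaK : W'.ShaFinite) {q : ℚ} (hq : 0 < q)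
    (hWR : (W'.shaOrder : ℝ) * W'.regulator * W'.bsdPeriod * (W'.tamagawaProduct : ℝ) /
        (W'.torsionOrder : ℝ) ^ 2 = (q : ℝ) * (W.bsdRHS * Wd.bsdRHS)) :
    shaAnOver W' * (W.shaOrder : ℂ) * (Wd.shaOrder : ℂ) * (q : ℂ) =
      shaAn W * shaAn Wd * (W'.shaOrder : ℂ) := by
  -- positivity over `ℚ`
  have hBW : 0 < W.bsdRHS := W.bsdRHS_pos' hshaW
  have hBD : 0 < Wd.bsdRHS := Wd.bsdRHS_pos' hshaD
  have hqR : (0 : ℝ) < q := by exact_mod_cast hq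
  have hB : 0 < (q : ℝ) * (W.bsdRHS * Wd.bsdRHS) := mul_pos hqR (mul_pos hBW hBD)
  have hsW : (0 : ℝ) < W.shaOrder := Nat.cast_pos.mpr (W.shaOrder_pos hshaW)
  have hsD : (0 : ℝ) < Wd.shaOrder := Nat.cast_pos.mpr (Wd.shaOrder_pos hshaD)
  have hsK : (0 : ℝ) < W'.shaOrder := Nat.cast_pos.mpr (W'.shaOrder_pos hshaK)
  have hRW : (0 : ℝ) < W.regulator := W.regulator_pos'
  have hRD : (0 : ℝ) < Wd.regulator := Wd.regulator_pos'
  have hΩW : (0 : ℝ) < W.realPeriodRat := W.realPeriodRat_pos_holds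
  have hΩD : (0 : ℝ) < Wd.realPeriodRat := Wd.realPeriodRat_pos_holds
  have hcW : (0 : ℝ) < W.tamagawaProduct := Nat.cast_pos.mpr W.tamagawaProduct_pos_holds
  have hcD : (0 : ℝ) < Wd.tamagawaProduct := Nat.cast_pos.mpr Wd.tamagawaProduct_pos_holds
  have htW : (0 : ℝ) < W.torsionOrder := Nat.cast_pos.mpr W.torsionOrder_pos_holds
  have htD : (0 : ℝ) < Wd.torsionOrder := Nat.cast_pos.mpr Wd.torsionOrder_pos_holds
  -- non-vanishing over `K`, read off the identity
  have htK : (W'.torsionOrder : ℝ) ≠ 0 := by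
    intro h0
    rw [h0, zero_pow two_ne_zero, div_zero] at hWR
    exact hB.ne hWR
  have hRK : W'.regulator ≠ 0 := by
    intro h0
    rw [h0, mul_zero, zero_mul, zero_mul, zero_div] at hWR
    exact hB.ne hWR
  have hΩK : W'.bsdPeriod ≠ 0 := by
    intro h0
    rw [h0, mul_zero, zero_mul, zero_div] at hWR
    exact hB.ne hWR
  have hcK : (W'.tamagawaProduct : ℝ) ≠ 0 := by
    intro h0
    rw [h0, mul_zero, zero_div] at hWR
    exact hB.ne hWR
  -- pass to `ℂ`
  have hL := leadingLCoeff_models_eq W K Wd W' hmod h2 hWd hW'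
  have hWR' : ((W'.shaOrder : ℝ) : ℂ) * (W'.regulator : ℂ) * (W'.bsdPeriod : ℂ) *
      ((W'.tamagawaProduct : ℝ) : ℂ) / ((W'.torsionOrder : ℝ) : ℂ) ^ 2 =
      ((q : ℝ) : ℂ) * ((W.bsdRHS : ℂ) * (Wd.bsdRHS : ℂ)) := by
    exact_mod_cast congrArg (fun x : ℝ => (x : ℂ)) hWR
  rw [shaAnOver, shaAn_def, shaAn_def, hL]
  rw [bsdRHS_def, bsdRHS_def] at hWR'
  push_cast at hWR' ⊢
  have hq' : (q : ℂ) ≠ 0 := by exact_mod_cast hq.ne'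
  have htK' : (W'.torsionOrder : ℂ) ≠ 0 := by exact_mod_cast htK
  have hRK' : (W'.regulator : ℂ) ≠ 0 := by exact_mod_cast hRK
  have hΩK' : (W'.bsdPeriod : ℂ) ≠ 0 := by exact_mod_cast hΩK
  have hcK' : (W'.tamagawaProduct : ℂ) ≠ 0 := by exact_mod_cast hcK
  have hRW' : (W.regulator : ℂ) ≠ 0 := by exact_mod_cast hRW.ne'
  have hRD' : (Wd.regulator : ℂ) ≠ 0 := by exact_mod_cast hRD.ne'
  have hΩW' : (W.realPeriodRat : ℂ) ≠ 0 := by exact_mod_cast hΩW.ne'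
  have hΩD' : (Wd.realPeriodRat : ℂ) ≠ 0 := by exact_mod_cast hΩD.ne'
  have hcW' : (W.tamagawaProduct : ℂ) ≠ 0 := by exact_mod_cast hcW.ne'
  have hcD' : (Wd.tamagawaProduct : ℂ) ≠ 0 := by exact_mod_cast hcD.ne'
  have htW' : (W.torsionOrder : ℂ) ≠ 0 := by exact_mod_cast htW.ne'
  have htD' : (Wd.torsionOrder : ℂ) ≠ 0 := by exact_mod_cast htD.ne'
  field_simp
  field_simp at hWR'
  linear_combination (-(W.leadingLCoeff * Wd.leadingLCoeff)) * hWR'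

/-- **DESCENT THEOREM, `ord_p`-SHAPED, WITH `Ш(W'/K)`-FINITENESS DISCHARGED.** Let `W/ℚ` be of
analytic rank `≤ 1`, `K` a quadratic field, `Wd` a `ℚ`-model of `W^{(d_K)}` of analytic rank
`≤ 1`, `W'` a `K`-model of `W_K`, and assume the `ord_p`-shaped Milne binder AT `p`:
`hWR_p : ∃ q ∈ ℚ_{>0}, v_p(q) = 0 ∧ #Ш(W')Reg(W')Ω(W')∏c_w(W')/#W'(K)_tors² = q·RHS(W)·RHS(Wd)`
(FILE C-4a's displayed shape; `hWR ⇒ hWR_p` with `q = 1`, `milneQuotient_ordp_of_eq`). THEN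
`MissingPPartOverAt W' p ∧ BSDp Wd p ⇒ BSDp W p`. Compared with
`Descent.bsdp_of_pPartOver_of_bsdp_twist`: the binder `hshaK : W'.ShaFinite` is GONE (tree
`shaFinite_baseChange_of_shaFinite`, fed by the finiteness of `Ш(W)`, `Ш(Wd)` from `hGZK`), and `hWR`
is weakened to `hWR_p`. Proof: (★) with the factor (`shaAnOver_mul_eq_ordp`) and the `ord_p`
bookkeeping `ord_p #Ш_an(W) = ord_p q' + ord_p #Ш(W) + ord_p #Ш(Wd) + ord_p q − ord_p #Ш(W') −
ord_p #Ш_an(Wd) = ord_p #Ш(W)` (`v_p(q) = 0`). [cite: Milne1972ArithmeticAV, §1 Thm. 1 and §2]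
[cite: Miller2011LMS, Def. 1.1 (arXiv:1010.2431 p. 3)] -/
theorem bsdp_of_pPartOver_of_bsdp_twist_ordp
    (hGZK : rank_eq_analyticRank_of_analyticRank_le_one) (hmod : hasEntireLFunction_rat)
    (hr : W.analyticRank ≤ 1) (h2 : Module.finrank ℚ K = 2)
    (hWd : ∃ C : VariableChange ℚ, C • W.quadraticTwist (NumberField.discr K : ℚ) = Wd)
    (hrd : Wd.analyticRank ≤ 1)
    (hW' : ∃ C : VariableChange K, C • W.baseChange K = W')
    (hWR_p : ∃ q : ℚ, 0 < q ∧ padicValRat p q = 0 ∧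
      (W'.shaOrder : ℝ) * W'.regulator * W'.bsdPeriod * (W'.tamagawaProduct : ℝ) /
        (W'.torsionOrder : ℝ) ^ 2 = (q : ℝ) * (W.bsdRHS * Wd.bsdRHS))
    (hK : MissingPPartOverAt W' p) (hd : BSDp Wd p) : BSDp W p := by
  obtain ⟨-, hfinW⟩ := hGZK W hr
  obtain ⟨-, hfinD⟩ := hGZK Wd hrd
  haveI : Finite W.sha := hfinW
  haveI : Finite Wd.sha := hfinD
  -- `Ш(W'/K)` finite: the tree theorem (no A65)
  have hshaK : W'.ShaFinite := shaFinite_baseChange_quadratic W K Wd W' h2 hWd hW' hfinW hfinD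
  obtain ⟨qM, hqM0, hqMp, hWR⟩ := hWR_p
  -- the two inputs, in Miller's currency
  obtain ⟨qd, hqd, hvd⟩ := missingPPartAt_of_bsdp Wd p hd
  obtain ⟨q', hq', hv'⟩ := hK
  -- (★) with the factor
  have hstar := shaAnOver_mul_eq_ordp W K Wd W' hmod h2 hWd hW' hfinW hfinD hshaK hqM0 hWR
  -- non-vanishing
  have hsW : W.shaOrder ≠ 0 := (W.shaOrder_pos hfinW).ne'
  have hsD : Wd.shaOrder ≠ 0 := (Wd.shaOrder_pos hfinD).ne'
  have hsK : W'.shaOrder ≠ 0 := (W'.shaOrder_pos hshaK).ne'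
  have hshaAnD_ne : shaAn Wd ≠ 0 := by
    intro h
    rw [shaAn_def, div_eq_zero_iff] at h
    rcases h with h | h
    · rcases mul_eq_zero.mp h with h | h
      · exact Wd.leadingLCoeff_ne_zero_holds (hmod Wd) h
      · exact (pow_ne_zero 2 (by exact_mod_cast Wd.torsionOrder_pos_holds.ne' :
          (Wd.torsionOrder : ℂ) ≠ 0)) h
    · rcases mul_eq_zero.mp h with h | h
      · rcases mul_eq_zero.mp h with h | h
        · exact (by exact_mod_cast Wd.realPeriodRat_pos_holds.ne' : (Wd.realPeriodRat : ℂ) ≠ 0) h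
        · exact (by exact_mod_cast Wd.tamagawaProduct_pos_holds.ne' :
            (Wd.tamagawaProduct : ℂ) ≠ 0) h
      · exact (by exact_mod_cast Wd.regulator_pos'.ne' : (Wd.regulator : ℂ) ≠ 0) h
  have hshaAnW_ne : shaAn W ≠ 0 := by
    intro h
    rw [shaAn_def, div_eq_zero_iff] at h
    rcases h with h | h
    · rcases mul_eq_zero.mp h with h | h
      · exact W.leadingLCoeff_ne_zero_holds (hmod W) h
      · exact (pow_ne_zero 2 (by exact_mod_cast W.torsionOrder_pos_holds.ne' :
          (W.torsionOrder : ℂ) ≠ 0)) h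
    · rcases mul_eq_zero.mp h with h | h
      · rcases mul_eq_zero.mp h with h | h
        · exact (by exact_mod_cast W.realPeriodRat_pos_holds.ne' : (W.realPeriodRat : ℂ) ≠ 0) h
        · exact (by exact_mod_cast W.tamagawaProduct_pos_holds.ne' :
            (W.tamagawaProduct : ℂ) ≠ 0) h
      · exact (by exact_mod_cast W.regulator_pos'.ne' : (W.regulator : ℂ) ≠ 0) h
  have hqd0 : qd ≠ 0 := by
    intro h0
    rw [h0, Rat.cast_zero] at hqd
    exact hshaAnD_ne hqd
  have hqM0' : qM ≠ 0 := hqM0.ne'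
  -- solve (★) for `#Ш_an(W)`
  set q : ℚ := q' * W.shaOrder * Wd.shaOrder * qM / (W'.shaOrder * qd) with hq_def
  have hshaAn : shaAn W = (q : ℂ) := by
    have hden : (W'.shaOrder : ℂ) * (qd : ℂ) ≠ 0 :=
      mul_ne_zero (by exact_mod_cast hsK) (by exact_mod_cast hqd0)
    rw [hq_def]
    push_cast
    rw [eq_div_iff hden, ← hqd, ← hq']
    linear_combination -hstar
  refine bsdp_of_missingPPartAt W p hGZK hr ⟨q, hshaAn, ?_⟩
  -- valuations
  have hq'0 : q' ≠ 0 := by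
    intro h0
    have : shaAn W * shaAn Wd * (W'.shaOrder : ℂ) = 0 := by
      rw [← hstar, hq', h0]; simp
    rcases mul_eq_zero.mp this with h | h
    · rcases mul_eq_zero.mp h with h | h
      · exact hshaAnW_ne h
      · exact hshaAnD_ne h
    · exact absurd (by exact_mod_cast h : W'.shaOrder = 0) hsK
  have hsWq : (W.shaOrder : ℚ) ≠ 0 := by exact_mod_cast hsW
  have hsDq : (Wd.shaOrder : ℚ) ≠ 0 := by exact_mod_cast hsD
  have hsKq : (W'.shaOrder : ℚ) ≠ 0 := by exact_mod_cast hsK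
  rw [hq_def, padicValRat.div (mul_ne_zero (mul_ne_zero (mul_ne_zero hq'0 hsWq) hsDq) hqM0')
      (mul_ne_zero hsKq hqd0),
    padicValRat.mul (mul_ne_zero (mul_ne_zero hq'0 hsWq) hsDq) hqM0',
    padicValRat.mul (mul_ne_zero hq'0 hsWq) hsDq, padicValRat.mul hq'0 hsWq,
    padicValRat.mul hsKq hqd0, hv', hvd, hqMp, padicValRat.of_nat, padicValRat.of_nat,
    padicValRat.of_nat]
  ring

/-- **The A65-shaped descent theorem minus `hshaK`**: `Descent.bsdp_of_pPartOver_of_bsdp_twist` with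
the binder `hshaK : W'.ShaFinite` DISCHARGED by the tree theorem (Milne's real identity `hWR` kept). For
consumers that keep `hWR` (A65 conjunct (2)) but want conjunct (1) as a theorem.
[cite: Milne1972ArithmeticAV, §1 Thm. 1 and §2] -/
theorem bsdp_of_pPartOver_of_bsdp_twist_noShaK
    (hGZK : rank_eq_analyticRank_of_analyticRank_le_one) (hmod : hasEntireLFunction_rat)
    (hr : W.analyticRank ≤ 1) (h2 : Module.finrank ℚ K = 2)
    (hWd : ∃ C : VariableChange ℚ, C • W.quadraticTwist (NumberField.discr K : ℚ) = Wd)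
    (hrd : Wd.analyticRank ≤ 1)
    (hW' : ∃ C : VariableChange K, C • W.baseChange K = W')
    (hWR : (W'.shaOrder : ℝ) * W'.regulator * W'.bsdPeriod * (W'.tamagawaProduct : ℝ) /
        (W'.torsionOrder : ℝ) ^ 2 = W.bsdRHS * Wd.bsdRHS)
    (hK : MissingPPartOverAt W' p) (hd : BSDp Wd p) : BSDp W p :=
  bsdp_of_pPartOver_of_bsdp_twist_ordp W p K Wd W' hGZK hmod hr h2 hWd hrd hW'
    (milneQuotient_ordp_of_eq W Wd W' p hWR) hK hd

end Descent

/-! ## §2 The A65-FREE ENDs: rank `0`, imaginary `K`, odd `p`, populations S₁ / S₂ -/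

section Ends

variable (W : WeierstrassCurve ℚ) [W.IsElliptic] [W.IsGloballyMinimal] (p : ℕ) [Fact p.Prime]
  (K : Type) [Field K] [NumberField K] [IsTotallyComplex K]
  (Wd : WeierstrassCurve ℚ) [Wd.IsElliptic] [Wd.IsGloballyMinimal]
  (W' : WeierstrassCurve K) [W'.IsElliptic] [W'.IsGloballyMinimal]

/-- **A65-FREE DESCENT END on S₁, EVERY ODD `p`.** Let `W/ℚ` be globally minimal of ANALYTIC RANK
`0`, `K` an IMAGINARY quadratic field with `d_K` odd squarefree (e.g. `K = ℚ(√−p)` for the additive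
prime `p ≡ 3 mod 4` of an X3♯(M)/X4(M) pair), `Wd = C_d • W^{(d_K)}` globally minimal of analytic
rank `0`, `W' = C' • W_K` globally minimal, `W` on S₁ — at every place `v`: good, or
multiplicative, or (`ℓ_v ∣ d_K` and `Wd` multiplicative at `v`, i.e. `W` potentially multiplicative
at the ramified prime) — and `p` an odd prime. THEN
**`BSDp W p ⟸ MissingPPartOverAt W' p ∧ BSDp Wd p`**, the only further hypotheses being the cell's
standing named facts `hGZK`, `hmod`. NO Milne hypothesis: `Ш(W'/K)` finite is the tree's
`shaFinite_baseChange_of_shaFinite`; `hWR_p` is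
FILE C-4b `milneQuotient_ordp_of_semistable'` (odd Tamagawa identity END #2 + the tree's
archimedean / torsion / `Ш` odd-part comparisons); `W(ℚ)`, `Wd(ℚ)` finite from analytic rank `0`
by `hGZK` (`mordellWeilRank_eq_zero_iff_finite`), hence `W'(K)` finite
(`finite_point_of_finite_of_finite_twist`). [cite: Milne1972ArithmeticAV, §1 Thm. 1 and §2 (through DokchitserDokchitserAnnals2010, §2.1, proof of Thm. 8)]
[cite: Miller2011LMS, Def. 1.1 (arXiv:1010.2431 p. 3)] -/
theorem bsdp_of_pPartOver_of_bsdp_twist_rankZero_semistable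
    (hGZK : rank_eq_analyticRank_of_analyticRank_le_one) (hmod : hasEntireLFunction_rat)
    (h2 : Module.finrank ℚ K = 2)
    (hdodd : Odd (NumberField.discr K)) (hdsq : Squarefree (NumberField.discr K))
    {Cd : VariableChange ℚ} (hWd : Cd • W.quadraticTwist (NumberField.discr K : ℚ) = Wd)
    {C' : VariableChange K} (hW' : C' • W.baseChange K = W')
    (hr : W.analyticRank = 0) (hrd : Wd.analyticRank = 0)
    (hS : ∀ v : HeightOneSpectrum (𝓞 ℚ), W.HasGoodReductionAt v ∨ W.HasMultiplicativeReductionAt v ∨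
      (((primesEquiv v : ℕ) : ℤ) ∣ NumberField.discr K ∧ Wd.HasMultiplicativeReductionAt v))
    (hp2 : p ≠ 2) (hK : MissingPPartOverAt W' p) (hd : BSDp Wd p) : BSDp W p := by
  have hr1 : W.analyticRank ≤ 1 := by rw [hr]; exact zero_le_one
  have hrd1 : Wd.analyticRank ≤ 1 := by rw [hrd]; exact zero_le_one
  obtain ⟨hrankW, hfinW⟩ := hGZK W hr1
  obtain ⟨hrankD, hfinD⟩ := hGZK Wd hrd1
  haveI : Finite W.sha := hfinW
  haveI : Finite Wd.sha := hfinD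
  haveI : Finite W.toAffine.Point := W.mordellWeilRank_eq_zero_iff_finite.mp (by rw [hrankW, hr])
  haveI : Finite Wd.toAffine.Point :=
    Wd.mordellWeilRank_eq_zero_iff_finite.mp (by rw [hrankD, hrd])
  haveI : Finite W'.toAffine.Point := finite_point_of_finite_of_finite_twist W K Wd W' h2 hWd hW'
  have hshaK : W'.ShaFinite :=
    shaFinite_baseChange_quadratic W K Wd W' h2 ⟨Cd, hWd⟩ ⟨C', hW'⟩ hfinW hfinD
  exact bsdp_of_pPartOver_of_bsdp_twist_ordp W p K Wd W' hGZK hmod hr1 h2 ⟨Cd, hWd⟩ hrd1 ⟨C', hW'⟩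
    (milneQuotient_ordp_of_semistable' W K Wd W' h2 hdodd hdsq hWd hW' hshaK hS p hp2) hK hd

/-- **A65-FREE DESCENT END on S₂, `p ≥ 5`.** As `bsdp_of_pPartOver_of_bsdp_twist_rankZero_semistable`
with ADDITIVE places of `W` of residue characteristic `≥ 5` prime to `d_K` also allowed in `hS`
(FILE C-4b `milneQuotient_ordp_of_semistable_or_addv`, END #3), and `p ≥ 5`. No Milne hypothesis;
`hGZK`, `hmod` only. [cite: Milne1972ArithmeticAV, §1 Thm. 1 and §2 (through DokchitserDokchitserAnnals2010, §2.1, proof of Thm. 8)]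
[cite: Miller2011LMS, Def. 1.1 (arXiv:1010.2431 p. 3)] -/
theorem bsdp_of_pPartOver_of_bsdp_twist_rankZero_semistable_or_addv
    (hGZK : rank_eq_analyticRank_of_analyticRank_le_one) (hmod : hasEntireLFunction_rat)
    (h2 : Module.finrank ℚ K = 2)
    (hdodd : Odd (NumberField.discr K)) (hdsq : Squarefree (NumberField.discr K))
    {Cd : VariableChange ℚ} (hWd : Cd • W.quadraticTwist (NumberField.discr K : ℚ) = Wd)
    {C' : VariableChange K} (hW' : C' • W.baseChange K = W')
    (hr : W.analyticRank = 0) (hrd : Wd.analyticRank = 0)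
    (hS : ∀ v : HeightOneSpectrum (𝓞 ℚ), W.HasGoodReductionAt v ∨ W.HasMultiplicativeReductionAt v ∨
      (((primesEquiv v : ℕ) : ℤ) ∣ NumberField.discr K ∧ Wd.HasMultiplicativeReductionAt v) ∨
      (W.HasAdditiveReductionAt v ∧ ¬ ((primesEquiv v : ℕ) : ℤ) ∣ NumberField.discr K ∧
        5 ≤ (primesEquiv v : ℕ)))
    (hp5 : 5 ≤ p) (hK : MissingPPartOverAt W' p) (hd : BSDp Wd p) : BSDp W p := by
  have hr1 : W.analyticRank ≤ 1 := by rw [hr]; exact zero_le_one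
  have hrd1 : Wd.analyticRank ≤ 1 := by rw [hrd]; exact zero_le_one
  obtain ⟨hrankW, hfinW⟩ := hGZK W hr1
  obtain ⟨hrankD, hfinD⟩ := hGZK Wd hrd1
  haveI : Finite W.sha := hfinW
  haveI : Finite Wd.sha := hfinD
  haveI : Finite W.toAffine.Point := W.mordellWeilRank_eq_zero_iff_finite.mp (by rw [hrankW, hr])
  haveI : Finite Wd.toAffine.Point :=
    Wd.mordellWeilRank_eq_zero_iff_finite.mp (by rw [hrankD, hrd])
  haveI : Finite W'.toAffine.Point := finite_point_of_finite_of_finite_twist W K Wd W' h2 hWd hW'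
  have hshaK : W'.ShaFinite :=
    shaFinite_baseChange_quadratic W K Wd W' h2 ⟨Cd, hWd⟩ ⟨C', hW'⟩ hfinW hfinD
  exact bsdp_of_pPartOver_of_bsdp_twist_ordp W p K Wd W' hGZK hmod hr1 h2 ⟨Cd, hWd⟩ hrd1 ⟨C', hW'⟩
    (milneQuotient_ordp_of_semistable_or_addv W K Wd W' h2 hdodd hdsq hWd hW' hshaK hS p hp5) hK hd

end Ends

end Summit.BirchSwinnertonDyer.Rank1Residual.AdditivePotMult

end
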